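import Literature.Geometry.Riemannian.LowEntropyHypersurfacesFourProofs
import Literature.Geometry.Riemannian.SphericalCylinderEntropy
import Literature.Geometry.Riemannian.ColdingMinicozziEntropyInvariance
import Mathlib
import HarnessLib

/-!
# Centre case `y = 0` of the sharp kernel domination `λ(Φ A) ≤ λ(S⁴) · λ_cyl(A)`

Helper for the line `conformal-kernel-domination` of the crux
`Summit.SmoothPoincare4.SmoothPoincare4.Theses.CylinderEntropy.SliceIsolation` (stub
`stub_entropyDomination`, the SHARP variant K1, off the main chain).  With
`N = {z ∈ ℝ⁶ | ∑_{i<5} zᵢ² = 1} = S⁴ × ℝ` and `Φ(z) = e^{z₅} z' ∈ ℝ⁵` (slices ↦ round spheres about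
`0`) we prove, for every measurable `A ⊆ N` and every scale `t > 0`,
`F_{0,t}(Φ A) ≤ λ(unit S⁴) · λ_cyl(A)` (`gaussianArea_zero_conformal_le`; `F`/`λ` = the tree's
Colding–Minicozzi `gaussianArea`/`gaussianEntropy` for `μHE[4]`, `λ_cyl` = the typed `cylEntropy`).

Proof (structural, no numerical constant): `Φ` is `eᵇ`-Lipschitz on `N ∩ {z₅ ≤ b}` (sharp:
`‖Φz − Φw‖² = (e^{z₅} − e^{w₅})² + 2e^{z₅+w₅}(1 − ⟨z',w'⟩) ≤ e^{2b}‖z − w‖²`), so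
`μHE⁴(Φ S) ≤ e^{4b} μHE⁴(S)` (`LipschitzOnWith.hausdorffMeasure_image_le`); on `Φ(N ∩ {a ≤ z₅})` the
weight is `≤ e^{−e^{2a}/4t}`, and the scaling identity `(4πt)⁻² e^{4a} e^{−e^{2a}/4t} =
(4πt')⁻² e^{−1/4t'}` (`t' = t e^{−2a}`) identifies the band constant with
`F_{0,t'}(S⁴)/μHE⁴(S⁴) ≤ λ(S⁴)/μHE⁴(S⁴)`; cutting `A` into the bands `{⌊z₅/h⌋ = k}` and summing
(`lintegral_iUnion_le`, `measure_iUnion`) gives `F_{0,t}(ΦA) ≤ e^{4h} λ(S⁴) μHE⁴(A)/μHE⁴(S⁴)` for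
all `h > 0`; the Haar factor of `μHE = c • μH` cancels, and `μH⁴(A)/μH⁴(S⁴) ≤ λ_cyl(A)` is the
tree's `measure_ratio_le_cylEntropy` after exhausting `A` by `A ∩ {|z₅| ≤ n}`.  Equality holds on
slices; the general centre `y ≠ 0` (the full stub) is NOT treated here.
-/

noncomputable section

open MeasureTheory Set Filter
open scoped ENNReal NNReal Topology BigOperators

set_option linter.dupNamespace false

namespace Summit.SmoothPoincare4.SmoothPoincare4.Theorems.CylinderEntropySliceIsolation

open Literature.Geometry.Riemannian
open Literature.Geometry.Riemannian.SphericalCylinderEntropy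

/-- Mean-value bound for `exp` below a level: `|eᵘ − eᵛ| ≤ eᵇ |u − v|` for `u, v ≤ b`. [folklore] -/
private theorem abs_exp_sub_exp_le {u v b : ℝ} (hu : u ≤ b) (hv : v ≤ b) :
    |Real.exp u - Real.exp v| ≤ Real.exp b * |u - v| := by
  wlog huv : v ≤ u generalizing u v
  · rw [abs_sub_comm, abs_sub_comm u v]
    exact this hv hu (not_le.1 huv).le
  rw [abs_of_nonneg (sub_nonneg.2 (Real.exp_le_exp.2 huv)), abs_of_nonneg (sub_nonneg.2 huv)]
  have h1 : v - u + 1 ≤ Real.exp (v - u) := Real.add_one_le_exp _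
  have h2 : Real.exp v = Real.exp u * Real.exp (v - u) := by rw [← Real.exp_add]; ring_nf
  have h3 : Real.exp u ≤ Real.exp b := Real.exp_le_exp.2 hu
  rw [h2]
  nlinarith [Real.exp_pos u, Real.exp_pos (v - u),
    mul_le_mul_of_nonneg_left h1 (Real.exp_pos u).le,
    mul_le_mul_of_nonneg_right h3 (sub_nonneg.2 huv)]

/-- **Sharp Lipschitz bound**: for `z, w ∈ N` of height `≤ b`, `‖Φ z − Φ w‖ ≤ eᵇ ‖z − w‖`. [folklore] -/
private theorem dist_conformal_le {z w : EuclideanSpace ℝ (Fin 6)} {b : ℝ}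
    (hz : ∑ i : Fin 5, z (Fin.castSucc i) ^ 2 = 1) (hw : ∑ i : Fin 5, w (Fin.castSucc i) ^ 2 = 1)
    (hzb : z 5 ≤ b) (hwb : w 5 ≤ b) :
    dist (WithLp.toLp 2 (fun i : Fin 5 => Real.exp (z 5) * z (Fin.castSucc i)) :
          EuclideanSpace ℝ (Fin 5))
        (WithLp.toLp 2 (fun i : Fin 5 => Real.exp (w 5) * w (Fin.castSucc i))) ≤
      Real.exp b * dist z w := by
  rw [← sq_le_sq₀ dist_nonneg (by positivity), mul_pow, EuclideanSpace.dist_eq,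
    EuclideanSpace.dist_eq, Real.sq_sqrt (Finset.sum_nonneg fun i _ => sq_nonneg _),
    Real.sq_sqrt (Finset.sum_nonneg fun i _ => sq_nonneg _)]
  simp only [Real.dist_eq, sq_abs]
  rw [Fin.sum_univ_castSucc (fun j : Fin 6 => (z j - w j) ^ 2)]
  simp only [show (Fin.last 5 : Fin 6) = 5 from rfl]
  set α := Real.exp (z 5)
  set β := Real.exp (w 5)
  set c := ∑ i : Fin 5, z (Fin.castSucc i) * w (Fin.castSucc i) with hc
  have h1 : ∑ i : Fin 5, (α * z (Fin.castSucc i) - β * w (Fin.castSucc i)) ^ 2 =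
      α ^ 2 * ∑ i : Fin 5, z (Fin.castSucc i) ^ 2 + β ^ 2 * ∑ i : Fin 5, w (Fin.castSucc i) ^ 2 -
        2 * α * β * c := by
    simp only [hc, Finset.mul_sum, ← Finset.sum_add_distrib, ← Finset.sum_sub_distrib]
    exact Finset.sum_congr rfl fun i _ => by ring
  have h2 : ∑ i : Fin 5, (z (Fin.castSucc i) - w (Fin.castSucc i)) ^ 2 =
      ∑ i : Fin 5, z (Fin.castSucc i) ^ 2 + ∑ i : Fin 5, w (Fin.castSucc i) ^ 2 - 2 * c := by
    simp only [hc, Finset.mul_sum, ← Finset.sum_add_distrib, ← Finset.sum_sub_distrib]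
    exact Finset.sum_congr rfl fun i _ => by ring
  rw [h1, h2, hz, hw]
  have hc1 : c ≤ 1 := (le_abs_self c).trans (abs_sum_mul_le_one hz hw)
  have hαb : α ≤ Real.exp b := Real.exp_le_exp.2 hzb
  have hαβ : (α - β) ^ 2 ≤ Real.exp b ^ 2 * (z 5 - w 5) ^ 2 := by
    have h := abs_exp_sub_exp_le hzb hwb
    rw [← sq_abs (α - β), ← sq_abs (z 5 - w 5), ← mul_pow]
    exact pow_le_pow_left₀ (abs_nonneg _) h 2
  have hprod : α * β ≤ Real.exp b * Real.exp b :=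
    mul_le_mul hαb (Real.exp_le_exp.2 hwb) (Real.exp_pos _).le (Real.exp_pos b).le
  nlinarith [mul_nonneg (sub_nonneg.2 hprod) (sub_nonneg.2 hc1)]

/-- `Φ` is `eᵇ`-Lipschitz on any `S ⊆ N ∩ {z₅ ≤ b}`. [folklore] -/
private theorem lipschitzOnWith_conformal {Φ : EuclideanSpace ℝ (Fin 6) → EuclideanSpace ℝ (Fin 5)}
    (hΦ : ∀ z, Φ z = WithLp.toLp 2 fun i : Fin 5 => Real.exp (z 5) * z (Fin.castSucc i))
    {S : Set (EuclideanSpace ℝ (Fin 6))} {b : ℝ}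
    (hSN : ∀ z ∈ S, ∑ i : Fin 5, z (Fin.castSucc i) ^ 2 = 1) (hSb : ∀ z ∈ S, z 5 ≤ b) :
    LipschitzOnWith (Real.toNNReal (Real.exp b)) Φ S :=
  LipschitzOnWith.of_dist_le_mul fun z hz w hw => by
    rw [Real.coe_toNNReal _ (Real.exp_pos b).le, hΦ, hΦ]
    exact dist_conformal_le (hSN z hz) (hSN w hw) (hSb z hz) (hSb w hw)

/-- **Push-forward bound**: `μHE⁴(Φ S) ≤ e^{4b} μHE⁴(S)` for `S ⊆ N ∩ {z₅ ≤ b}`. [folklore] -/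
private theorem measure_image_conformal_le {Φ : EuclideanSpace ℝ (Fin 6) → EuclideanSpace ℝ (Fin 5)}
    (hΦ : ∀ z, Φ z = WithLp.toLp 2 fun i : Fin 5 => Real.exp (z 5) * z (Fin.castSucc i))
    {S : Set (EuclideanSpace ℝ (Fin 6))} {b : ℝ}
    (hSN : ∀ z ∈ S, ∑ i : Fin 5, z (Fin.castSucc i) ^ 2 = 1) (hSb : ∀ z ∈ S, z 5 ≤ b) :
    (μHE[4] : Measure (EuclideanSpace ℝ (Fin 5))) (Φ '' S) ≤
      ENNReal.ofReal (Real.exp (4 * b)) * (μHE[4] : Measure (EuclideanSpace ℝ (Fin 6))) S := by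
  have hL := (lipschitzOnWith_conformal hΦ hSN hSb).hausdorffMeasure_image_le (d := ((4 : ℕ) : ℝ))
    (by positivity)
  rw [ENNReal.rpow_natCast] at hL
  have hK : ((Real.toNNReal (Real.exp b) : ℝ≥0∞)) ^ 4 = ENNReal.ofReal (Real.exp (4 * b)) := by
    rw [show (4 : ℝ) * b = ((4 : ℕ) : ℝ) * b by norm_num, Real.exp_nat_mul,
      ENNReal.ofReal_pow (Real.exp_pos b).le]
    rfl
  rw [Measure.euclideanHausdorffMeasure_def, Measure.euclideanHausdorffMeasure_def, Measure.smul_apply,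
    Measure.smul_apply, ENNReal.smul_def, ENNReal.smul_def, smul_eq_mul, smul_eq_mul, ← hK,
    mul_left_comm]
  exact mul_le_mul_right hL _

/-- On `N`, `‖Φ z‖² = e^{2 z₅}`. [folklore] -/
private theorem norm_sq_conformal {z : EuclideanSpace ℝ (Fin 6)}
    (hz : ∑ i : Fin 5, z (Fin.castSucc i) ^ 2 = 1) :
    ‖(WithLp.toLp 2 (fun i : Fin 5 => Real.exp (z 5) * z (Fin.castSucc i)) :
        EuclideanSpace ℝ (Fin 5))‖ ^ 2 = Real.exp (z 5) ^ 2 := by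
  rw [EuclideanSpace.real_norm_sq_eq]
  simp only [mul_pow]
  rw [← Finset.mul_sum, hz, mul_one]

/-- The Gaussian weight centred at `0` on `Φ(S)`, `S ⊆ N ∩ {a ≤ z₅}`, is `≤ e^{−e^{2a}/4t}`. [folklore] -/
private theorem gaussianWeight_conformal_le {Φ : EuclideanSpace ℝ (Fin 6) → EuclideanSpace ℝ (Fin 5)}
    (hΦ : ∀ z, Φ z = WithLp.toLp 2 fun i : Fin 5 => Real.exp (z 5) * z (Fin.castSucc i))
    {S : Set (EuclideanSpace ℝ (Fin 6))} {a t : ℝ} (ht : 0 < t)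
    (hSN : ∀ z ∈ S, ∑ i : Fin 5, z (Fin.castSucc i) ^ 2 = 1) (hSa : ∀ z ∈ S, a ≤ z 5) :
    ∀ x ∈ Φ '' S, gaussianWeight (0 : EuclideanSpace ℝ (Fin 5)) t x ≤
      ENNReal.ofReal (Real.exp (-(Real.exp a ^ 2) / (4 * t))) := by
  rintro _ ⟨z, hz, rfl⟩
  rw [hΦ]
  simp only [gaussianWeight, sub_zero]
  rw [norm_sq_conformal (hSN z hz)]
  refine ENNReal.ofReal_le_ofReal (Real.exp_le_exp.2 ?_)
  have h1 : Real.exp a ^ 2 ≤ Real.exp (z 5) ^ 2 :=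
    pow_le_pow_left₀ (Real.exp_pos a).le (Real.exp_le_exp.2 (hSa z hz)) 2
  have h4 : (0 : ℝ) < 4 * t := by positivity
  rw [div_le_div_iff_of_pos_right h4]
  linarith

/-- `(4πt)^{-2}` written without `rpow`. [folklore] -/
private theorem gaussianNormalization_four {t : ℝ} (ht : 0 < t) :
    gaussianNormalization 4 t = ENNReal.ofReal (((4 * Real.pi * t) ^ 2)⁻¹) := by
  unfold gaussianNormalization
  rw [show (-((4 : ℕ) : ℝ) / 2) = -(2 : ℝ) by norm_num, Real.rpow_neg (by positivity), Real.rpow_two]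

/-- **Scaling**: `(4πt)⁻² e^{−e^{2a}/4t} e^{4(a+h)} = e^{4h} (4πt')⁻² e^{−1/4t'}`, `t' = t e^{−2a}`. [folklore] -/
private theorem band_constant_eq {t : ℝ} (ht : 0 < t) (a h : ℝ) :
    gaussianNormalization 4 t * ENNReal.ofReal (Real.exp (-(Real.exp a ^ 2) / (4 * t))) *
        ENNReal.ofReal (Real.exp (4 * (a + h))) =
      ENNReal.ofReal (Real.exp (4 * h)) *
        (gaussianNormalization 4 (t * (Real.exp a ^ 2)⁻¹) *
          ENNReal.ofReal (Real.exp (-1 / (4 * (t * (Real.exp a ^ 2)⁻¹))))) := by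
  have ht' : 0 < t * (Real.exp a ^ 2)⁻¹ := by positivity
  rw [gaussianNormalization_four ht, gaussianNormalization_four ht',
    ← ENNReal.ofReal_mul (by positivity), ← ENNReal.ofReal_mul (by positivity),
    ← ENNReal.ofReal_mul (by positivity), ← ENNReal.ofReal_mul (by positivity)]
  congr 1
  have harg : -1 / (4 * (t * (Real.exp a ^ 2)⁻¹)) = -(Real.exp a ^ 2) / (4 * t) := by
    field_simp
  have h4 : Real.exp (4 * (a + h)) = Real.exp (4 * h) * Real.exp a ^ 4 := by
    rw [show 4 * (a + h) = 4 * h + ((4 : ℕ) : ℝ) * a by push_cast; ring, Real.exp_add,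
      Real.exp_nat_mul]
  rw [harg, h4]
  field_simp

/-- **Round sphere from its centre**: `(4πt)⁻² e^{−1/4t} ≤ λ(S⁴)/μHE⁴(S⁴)` (`F_{0,t}(S⁴) ≤ λ(S⁴)`). [folklore] -/
private theorem sphere_constant_le {t : ℝ} (ht : 0 < t) :
    gaussianNormalization 4 t * ENNReal.ofReal (Real.exp (-1 / (4 * t))) ≤
      gaussianEntropy 4 (Metric.sphere (0 : EuclideanSpace ℝ (Fin 5)) 1) *
        ((μHE[4] : Measure (EuclideanSpace ℝ (Fin 5))) (Metric.sphere 0 1))⁻¹ := by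
  have hV0 := Literature.MeasureTheory.Hausdorff.euclideanHausdorffMeasure_unitSphere_pos
    (E := EuclideanSpace ℝ (Fin 5)) (d := 4) finrank_euclideanSpace_fin (by norm_num)
  have hVt : (μHE[4] : Measure (EuclideanSpace ℝ (Fin 5))) (Metric.sphere 0 1) < ⊤ := by
    rw [Literature.MeasureTheory.Hausdorff.euclideanHausdorffMeasure_unitSphere_general
      (E := EuclideanSpace ℝ (Fin 5)) (d := 4) finrank_euclideanSpace_fin (by norm_num)]
    exact ENNReal.ofReal_lt_top
  rw [← div_eq_mul_inv, ENNReal.le_div_iff_mul_le (Or.inl hV0.ne') (Or.inl hVt.ne)]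
  refine le_trans ?_ (gaussianArea_le_gaussianEntropy 4 (0 : EuclideanSpace ℝ (Fin 5)) ht _)
  rw [gaussianArea_eq, mul_assoc, ← setLIntegral_const]
  refine mul_le_mul_right (setLIntegral_mono (measurable_gaussianWeight _ _) fun x hx => ?_) _
  refine le_of_eq ?_
  simp only [gaussianWeight, sub_zero, mem_sphere_zero_iff_norm.1 hx, one_pow]

/-- **Band estimate**: `F_{0,t}(Φ S) ≤ e^{4h} · C · μHE⁴(S)` for `S ⊆ N ∩ {a ≤ z₅ ≤ a + h}`. [folklore] -/
private theorem gaussianArea_conformal_band_le {Φ : EuclideanSpace ℝ (Fin 6) → EuclideanSpace ℝ (Fin 5)}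
    (hΦ : ∀ z, Φ z = WithLp.toLp 2 fun i : Fin 5 => Real.exp (z 5) * z (Fin.castSucc i))
    {S : Set (EuclideanSpace ℝ (Fin 6))} {a h t : ℝ} (ht : 0 < t)
    (hSN : ∀ z ∈ S, ∑ i : Fin 5, z (Fin.castSucc i) ^ 2 = 1) (hSa : ∀ z ∈ S, a ≤ z 5)
    (hSb : ∀ z ∈ S, z 5 ≤ a + h) {C : ℝ≥0∞}
    (hC : ∀ t' : ℝ, 0 < t' → gaussianNormalization 4 t' * ENNReal.ofReal (Real.exp (-1 / (4 * t'))) ≤ C) :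
    gaussianArea 4 (0 : EuclideanSpace ℝ (Fin 5)) t (Φ '' S) ≤
      ENNReal.ofReal (Real.exp (4 * h)) * C * (μHE[4] : Measure (EuclideanSpace ℝ (Fin 6))) S := by
  have ht' : 0 < t * (Real.exp a ^ 2)⁻¹ := by positivity
  calc gaussianArea 4 (0 : EuclideanSpace ℝ (Fin 5)) t (Φ '' S)
      ≤ gaussianNormalization 4 t * (ENNReal.ofReal (Real.exp (-(Real.exp a ^ 2) / (4 * t))) *
          (μHE[4] : Measure (EuclideanSpace ℝ (Fin 5))) (Φ '' S)) := by
        rw [gaussianArea_eq, ← setLIntegral_const]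
        exact mul_le_mul_right (setLIntegral_mono measurable_const
          (gaussianWeight_conformal_le hΦ ht hSN hSa)) _
    _ ≤ gaussianNormalization 4 t * (ENNReal.ofReal (Real.exp (-(Real.exp a ^ 2) / (4 * t))) *
          (ENNReal.ofReal (Real.exp (4 * (a + h))) *
            (μHE[4] : Measure (EuclideanSpace ℝ (Fin 6))) S)) := by
        gcongr
        exact measure_image_conformal_le hΦ hSN hSb
    _ = gaussianNormalization 4 t * ENNReal.ofReal (Real.exp (-(Real.exp a ^ 2) / (4 * t))) *
          ENNReal.ofReal (Real.exp (4 * (a + h))) *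
          (μHE[4] : Measure (EuclideanSpace ℝ (Fin 6))) S := by ring
    _ = ENNReal.ofReal (Real.exp (4 * h)) * (gaussianNormalization 4 (t * (Real.exp a ^ 2)⁻¹) *
          ENNReal.ofReal (Real.exp (-1 / (4 * (t * (Real.exp a ^ 2)⁻¹))))) *
          (μHE[4] : Measure (EuclideanSpace ℝ (Fin 6))) S := by rw [band_constant_eq ht a h]
    _ ≤ ENNReal.ofReal (Real.exp (4 * h)) * C * (μHE[4] : Measure (EuclideanSpace ℝ (Fin 6))) S :=
        mul_le_mul_left (mul_le_mul_right (hC _ ht') _) _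

/-- The height coordinate is continuous. [folklore] -/
private theorem continuous_height : Continuous fun z : EuclideanSpace ℝ (Fin 6) => z 5 :=
  PiLp.continuous_apply 2 _ 5

/-- **Fixed band width**: `F_{0,t}(Φ A) ≤ e^{4h} · C · μHE⁴(A)` (bands `{⌊z₅/h⌋ = k}`, summed). [folklore] -/
private theorem gaussianArea_conformal_le_exp_mul
    {Φ : EuclideanSpace ℝ (Fin 6) → EuclideanSpace ℝ (Fin 5)}
    (hΦ : ∀ z, Φ z = WithLp.toLp 2 fun i : Fin 5 => Real.exp (z 5) * z (Fin.castSucc i))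
    {A : Set (EuclideanSpace ℝ (Fin 6))}
    (hAN : ∀ z ∈ A, ∑ i : Fin 5, z (Fin.castSucc i) ^ 2 = 1) (hAm : MeasurableSet A)
    {t : ℝ} (ht : 0 < t) {h : ℝ} (hh : 0 < h) {C : ℝ≥0∞}
    (hC : ∀ t' : ℝ, 0 < t' → gaussianNormalization 4 t' * ENNReal.ofReal (Real.exp (-1 / (4 * t'))) ≤ C) :
    gaussianArea 4 (0 : EuclideanSpace ℝ (Fin 5)) t (Φ '' A) ≤
      ENNReal.ofReal (Real.exp (4 * h)) * C * (μHE[4] : Measure (EuclideanSpace ℝ (Fin 6))) A := by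
  have hBm : ∀ k : ℤ, MeasurableSet (A ∩ {z : EuclideanSpace ℝ (Fin 6) | ⌊z 5 / h⌋ = k}) := fun k =>
    hAm.inter ((Int.measurable_floor.comp (continuous_height.measurable.div_const h))
      (measurableSet_singleton k))
  have hBd : Pairwise (Function.onFun Disjoint
      fun k : ℤ => A ∩ {z : EuclideanSpace ℝ (Fin 6) | ⌊z 5 / h⌋ = k}) :=
    fun j k hjk => Set.disjoint_left.2 fun z hzj hzk => hjk (hzj.2.symm.trans hzk.2)
  have hBU : (⋃ k : ℤ, A ∩ {z : EuclideanSpace ℝ (Fin 6) | ⌊z 5 / h⌋ = k}) = A := by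
    ext z
    simp only [mem_iUnion, mem_inter_iff, mem_setOf_eq]
    exact ⟨fun ⟨k, hz, _⟩ => hz, fun hz => ⟨_, hz, rfl⟩⟩
  have hband : ∀ k : ℤ,
      gaussianArea 4 (0 : EuclideanSpace ℝ (Fin 5)) t
          (Φ '' (A ∩ {z : EuclideanSpace ℝ (Fin 6) | ⌊z 5 / h⌋ = k})) ≤
        ENNReal.ofReal (Real.exp (4 * h)) * C *
          (μHE[4] : Measure (EuclideanSpace ℝ (Fin 6))) (A ∩ {z | ⌊z 5 / h⌋ = k}) := by
    intro k
    refine gaussianArea_conformal_band_le hΦ ht (a := k * h) (fun z hz => hAN z hz.1)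
      (fun z hz => ?_) (fun z hz => ?_) hC
    · have h1 := (Int.floor_eq_iff.1 hz.2).1
      rwa [le_div_iff₀ hh] at h1
    · have h1 := (Int.floor_eq_iff.1 hz.2).2
      rw [div_lt_iff₀ hh] at h1
      linarith
  calc gaussianArea 4 (0 : EuclideanSpace ℝ (Fin 5)) t (Φ '' A)
      = gaussianNormalization 4 t *
          ∫⁻ x in ⋃ k : ℤ, Φ '' (A ∩ {z : EuclideanSpace ℝ (Fin 6) | ⌊z 5 / h⌋ = k}),
            gaussianWeight (0 : EuclideanSpace ℝ (Fin 5)) t x ∂μHE[4] := by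
        rw [gaussianArea_eq, ← image_iUnion, hBU]
    _ ≤ gaussianNormalization 4 t *
          ∑' k : ℤ, ∫⁻ x in Φ '' (A ∩ {z : EuclideanSpace ℝ (Fin 6) | ⌊z 5 / h⌋ = k}),
            gaussianWeight (0 : EuclideanSpace ℝ (Fin 5)) t x ∂μHE[4] := by
        gcongr
        exact lintegral_iUnion_le _ _
    _ = ∑' k : ℤ, gaussianArea 4 (0 : EuclideanSpace ℝ (Fin 5)) t
          (Φ '' (A ∩ {z : EuclideanSpace ℝ (Fin 6) | ⌊z 5 / h⌋ = k})) := by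
        rw [← ENNReal.tsum_mul_left]
        rfl
    _ ≤ ∑' k : ℤ, ENNReal.ofReal (Real.exp (4 * h)) * C *
          (μHE[4] : Measure (EuclideanSpace ℝ (Fin 6))) (A ∩ {z | ⌊z 5 / h⌋ = k}) :=
        ENNReal.tsum_le_tsum hband
    _ = ENNReal.ofReal (Real.exp (4 * h)) * C * (μHE[4] : Measure (EuclideanSpace ℝ (Fin 6))) A := by
        rw [ENNReal.tsum_mul_left, ← measure_iUnion hBd hBm, hBU]

/-- **Band width to zero**: `F_{0,t}(Φ A) ≤ C · μHE⁴(A)`. [folklore] -/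
private theorem gaussianArea_conformal_le_mul
    {Φ : EuclideanSpace ℝ (Fin 6) → EuclideanSpace ℝ (Fin 5)}
    (hΦ : ∀ z, Φ z = WithLp.toLp 2 fun i : Fin 5 => Real.exp (z 5) * z (Fin.castSucc i))
    {A : Set (EuclideanSpace ℝ (Fin 6))}
    (hAN : ∀ z ∈ A, ∑ i : Fin 5, z (Fin.castSucc i) ^ 2 = 1) (hAm : MeasurableSet A)
    {t : ℝ} (ht : 0 < t) {C : ℝ≥0∞}
    (hC : ∀ t' : ℝ, 0 < t' → gaussianNormalization 4 t' * ENNReal.ofReal (Real.exp (-1 / (4 * t'))) ≤ C) :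
    gaussianArea 4 (0 : EuclideanSpace ℝ (Fin 5)) t (Φ '' A) ≤
      C * (μHE[4] : Measure (EuclideanSpace ℝ (Fin 6))) A := by
  refine ENNReal.le_of_forall_lt_one_mul_le fun r hr => ?_
  rcases eq_or_ne r 0 with rfl | hr0
  · simp
  have hrt : r ≠ ⊤ := hr.ne_top
  have hρ0 : 0 < r.toReal := ENNReal.toReal_pos hr0 hrt
  have hρ1 : r.toReal < 1 := by
    have := (ENNReal.toReal_lt_toReal hrt ENNReal.one_ne_top).2 hr
    simpa using this
  have hlog : Real.log r.toReal < 0 := Real.log_neg hρ0 hρ1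
  set h : ℝ := -Real.log r.toReal / 4 with hh
  have hh0 : 0 < h := by rw [hh]; linarith
  have hexp : Real.exp (4 * h) = r.toReal⁻¹ := by
    rw [hh, show 4 * (-Real.log r.toReal / 4) = -Real.log r.toReal by ring, Real.exp_neg,
      Real.exp_log hρ0]
  have hone : r * ENNReal.ofReal (Real.exp (4 * h)) = 1 := by
    rw [hexp, ← ENNReal.ofReal_toReal hrt, ENNReal.toReal_ofReal hρ0.le,
      ← ENNReal.ofReal_mul hρ0.le, mul_inv_cancel₀ hρ0.ne', ENNReal.ofReal_one]
  calc r * gaussianArea 4 (0 : EuclideanSpace ℝ (Fin 5)) t (Φ '' A)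
      ≤ r * (ENNReal.ofReal (Real.exp (4 * h)) * C *
          (μHE[4] : Measure (EuclideanSpace ℝ (Fin 6))) A) :=
        mul_le_mul_right (gaussianArea_conformal_le_exp_mul hΦ hAN hAm ht hh0 hC) _
    _ = r * ENNReal.ofReal (Real.exp (4 * h)) *
          (C * (μHE[4] : Measure (EuclideanSpace ℝ (Fin 6))) A) := by ring
    _ = C * (μHE[4] : Measure (EuclideanSpace ℝ (Fin 6))) A := by rw [hone, one_mul]

/-- The Haar factor cancels: `μHE⁴(A)/μHE⁴(S⁴) = μH⁴(A)/μH⁴(S⁴)`. [folklore] -/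
private theorem ratio_euclideanHausdorff_eq (A : Set (EuclideanSpace ℝ (Fin 6))) :
    ((μHE[4] : Measure (EuclideanSpace ℝ (Fin 5))) (Metric.sphere 0 1))⁻¹ *
        (μHE[4] : Measure (EuclideanSpace ℝ (Fin 6))) A =
      (μH[4] (Metric.sphere (0 : EuclideanSpace ℝ (Fin 5)) 1))⁻¹ * μH[4] A := by
  have hc0 : ((MeasureTheory.Measure.addHaarScalarFactor (volume : Measure (EuclideanSpace ℝ (Fin 4)))
      (μH[((4 : ℕ) : ℝ)] : Measure (EuclideanSpace ℝ (Fin 4))) : ℝ≥0) : ℝ≥0∞) ≠ 0 :=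
    ENNReal.coe_ne_zero.2 (MeasureTheory.Measure.addHaarScalarFactor_volume_hausdorffMeasure_ne_zero 4)
  rw [Measure.euclideanHausdorffMeasure_def, Measure.euclideanHausdorffMeasure_def, Measure.smul_apply,
    Measure.smul_apply, ENNReal.smul_def, ENNReal.smul_def, smul_eq_mul, smul_eq_mul,
    ENNReal.mul_inv (Or.inl hc0) (Or.inl ENNReal.coe_ne_top), mul_mul_mul_comm,
    ENNReal.inv_mul_cancel hc0 ENNReal.coe_ne_top, one_mul]
  simp only [Nat.cast_ofNat]

/-- Monotonicity of the typed cylinder entropy in the set. [folklore] -/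
private theorem cylEntropy_mono_set {A B : Set (EuclideanSpace ℝ (Fin 6))} (h : A ⊆ B) :
    cylEntropy A ≤ cylEntropy B := by
  unfold cylEntropy cylDensity
  exact iSup₂_mono fun p _ => iSup₂_mono fun τ _ => mul_le_mul_right (lintegral_mono_set h) _

/-- **`μH⁴(A)/μH⁴(S⁴) ≤ λ_cyl(A)` for every measurable `A ⊆ N`** (no height bound: exhaust `A` by
`A ∩ {|z₅| ≤ n}` and use the tree's bounded-height `measure_ratio_le_cylEntropy`). [folklore] -/
theorem hausdorffMeasure_ratio_le_cylEntropy_of_subset {A : Set (EuclideanSpace ℝ (Fin 6))}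
    (hAm : MeasurableSet A) (hAN : ∀ z ∈ A, ∑ i : Fin 5, z (Fin.castSucc i) ^ 2 = 1) :
    (μH[4] (Metric.sphere (0 : EuclideanSpace ℝ (Fin 5)) 1))⁻¹ * μH[4] A ≤ cylEntropy A := by
  have hmono : Monotone fun n : ℕ => A ∩ {z : EuclideanSpace ℝ (Fin 6) | |z 5| ≤ n} := by
    intro m n hmn z hz
    exact ⟨hz.1, (show |z 5| ≤ (m : ℝ) from hz.2).trans (Nat.cast_le.2 hmn)⟩
  have hU : (⋃ n : ℕ, A ∩ {z : EuclideanSpace ℝ (Fin 6) | |z 5| ≤ n}) = A := by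
    ext z
    simp only [mem_iUnion, mem_inter_iff, mem_setOf_eq]
    refine ⟨fun ⟨n, hz, _⟩ => hz, fun hz => ?_⟩
    obtain ⟨n, hn⟩ := exists_nat_ge |z 5|
    exact ⟨n, hz, hn⟩
  have hμ : μH[4] A = ⨆ n : ℕ, μH[4] (A ∩ {z : EuclideanSpace ℝ (Fin 6) | |z 5| ≤ n}) := by
    rw [← hmono.measure_iUnion, hU]
  rw [hμ, ENNReal.mul_iSup]
  refine iSup_le fun n => ?_
  calc _ ≤ cylEntropy (A ∩ {z : EuclideanSpace ℝ (Fin 6) | |z 5| ≤ n}) :=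
        measure_ratio_le_cylEntropy
          (hAm.inter (measurableSet_le (continuous_height.measurable.abs) measurable_const))
          (fun z hz => hAN z hz.1) (B := n) (fun z hz => hz.2)
    _ ≤ cylEntropy A := cylEntropy_mono_set inter_subset_left

/-- **Centre case `y = 0` of the sharp kernel domination** (line `conformal-kernel-domination`,
stub `stub_entropyDomination`, K1 of the idea card): for every measurable `A ⊆ N = S⁴ × ℝ ⊂ ℝ⁶`
and every scale `t > 0`, the Colding–Minicozzi Gaussian area of the conformal image
`Φ(A) ⊂ ℝ⁵`, `Φ(z) = e^{z₅} z'`, centred at the origin is at most `λ(unit S⁴) · λ_cyl(A)`.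
(Sharp: equality on every slice `S⁴ × {s}`, whose image is the round sphere of radius `eˢ`.) [folklore] -/
theorem gaussianArea_zero_conformal_le (A : Set (EuclideanSpace ℝ (Fin 6)))
    (hA : A ⊆ {z : EuclideanSpace ℝ (Fin 6) | ∑ i : Fin 5, z (Fin.castSucc i) ^ 2 = 1})
    (hAm : MeasurableSet A) (t : ℝ) (ht : 0 < t) :
    gaussianArea 4 (0 : EuclideanSpace ℝ (Fin 5)) t
        ((fun z : EuclideanSpace ℝ (Fin 6) =>
          (WithLp.toLp 2 (fun i : Fin 5 => Real.exp (z 5) * z (Fin.castSucc i)) :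
            EuclideanSpace ℝ (Fin 5))) '' A) ≤
      gaussianEntropy 4 (Metric.sphere (0 : EuclideanSpace ℝ (Fin 5)) 1) * cylEntropy A := by
  have hAN : ∀ z ∈ A, ∑ i : Fin 5, z (Fin.castSucc i) ^ 2 = 1 := fun z hz => hA hz
  calc _ ≤ gaussianEntropy 4 (Metric.sphere (0 : EuclideanSpace ℝ (Fin 5)) 1) *
          ((μHE[4] : Measure (EuclideanSpace ℝ (Fin 5))) (Metric.sphere 0 1))⁻¹ *
          (μHE[4] : Measure (EuclideanSpace ℝ (Fin 6))) A :=
        gaussianArea_conformal_le_mul (fun z => rfl) hAN hAm ht fun t' ht' => sphere_constant_le ht'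
    _ = gaussianEntropy 4 (Metric.sphere (0 : EuclideanSpace ℝ (Fin 5)) 1) *
          ((μH[4] (Metric.sphere (0 : EuclideanSpace ℝ (Fin 5)) 1))⁻¹ * μH[4] A) := by
        rw [mul_assoc, ratio_euclideanHausdorff_eq]
    _ ≤ gaussianEntropy 4 (Metric.sphere (0 : EuclideanSpace ℝ (Fin 5)) 1) * cylEntropy A := by
        gcongr
        exact hausdorffMeasure_ratio_le_cylEntropy_of_subset hAm hAN

/-- Registered form (stub `helper_centreDomination` of the crux item `stmt-SmoothPoincare4-7632`) of
`gaussianArea_zero_conformal_le`. [folklore] -/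
theorem helper_centreDomination :
    ∀ (A : Set (EuclideanSpace ℝ (Fin 6))),
      A ⊆ {z : EuclideanSpace ℝ (Fin 6) | ∑ i : Fin 5, z (Fin.castSucc i) ^ 2 = 1} → MeasurableSet A →
      ∀ (t : ℝ), 0 < t →
        gaussianArea 4 (0 : EuclideanSpace ℝ (Fin 5)) t
            ((fun z : EuclideanSpace ℝ (Fin 6) =>
              (WithLp.toLp 2 (fun i : Fin 5 => Real.exp (z 5) * z (Fin.castSucc i)) :
                EuclideanSpace ℝ (Fin 5))) '' A) ≤
          gaussianEntropy 4 (Metric.sphere (0 : EuclideanSpace ℝ (Fin 5)) 1) * cylEntropy A :=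
  gaussianArea_zero_conformal_le

end Summit.SmoothPoincare4.SmoothPoincare4.Theorems.CylinderEntropySliceIsolation
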